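import Summits.QuantumFields.BalabanUV.T4Continuum.Support.NE7K1LinStripClassSumsHolder
import Summits.QuantumFields.BalabanUV.T4Continuum.Support.NE7K1LinStripClassLine

/-!
# NE7K1LinStripClassLineHolder — row NE7 (node U5), candidate route HOM, path H1L, cell K1-lin(s): NEEDS-ESTIMATE #E1, R-E1 TRANCHE D —
# B4 (2.35) SECOND QUANTITY AND (2.36) FOR THE TWO-CUTOFF LINE: the lattice kernels of the differentiated and of the Hölder-quotient
# multipliers of `∂^ξ_μ(σ_s^{(n)} + aQ*Q)⁻¹Q*` decay exponentially with ONE rate `κ_line(d+1,a₋,a₊)` and constants in `(d, α, a₋, a₊)`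
# ALONE, for EVERY `s ∈ [0,1]`, mesh `n ≥ 1`, `L ≥ 1`, `a ∈ [a₋,a₊]`, `τ`, `μ`, separation `0 < |sv|_∞ ≤ n`; and on every finite torus
# uniformly in the volume (pv17's periodisation BY NAME)

Lineage `b2b-balaban-t4-ne7-p2` (CRUX PROVER NE7 #2), generation 76; file 71.  Files 69 ∕ 70 re-typed b04's derivative and Hölder halves over
the class (`dkernelS_decay`, `hkernelS_decay`); file 66 put the line's symbol in the class for every `s`; file 68 did the first quantity
for the line.  THIS FILE ([folklore]; assembly BY NAME):

* §1 THE TORUS JOINERS OVER THE CLASS for the two further multipliers (b04's `torusKernelD248` ∕ `torusKernelH248` with `GD ↦ GDS`,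
  `GH ↦ GHS`): `torusKernelDS`, `torusKernelHS` (explicit finite sums, `= MultiPeriod.torusKernel (descendC …)` by `rfl`),
  `torusKernelD248_eq_torusKernelDS ∕ torusKernelH248_eq_torusKernelHS` (`rfl`), and for `σ ∈ S`: `torusKernelDS_decay_torusMetric`,
  `torusKernelDS_eq_periodise`, `torusKernelHS_decay_torusMetric`, `torusKernelHS_eq_periodise`.
* §2 **THE LINE, SECOND QUANTITY**: `line_GDS_stripRegular`, **`line_dkernel_decay`** (`‖latticeKernel (GDS n σ_s^{(n)} a τ μ) x‖ ≤
  MD_line(d,a₋)·e^{−κ_line|x|_∞}`), **`line_dtorusKernel_decay_torusMetric`**, `line_dtorusKernel_eq_periodise`.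
* §3 **THE LINE, HÖLDER QUOTIENT (2.36)**: `line_GHS_stripRegular`, **`line_hkernel_decay`** (`‖latticeKernel (GHS α n σ_s^{(n)} a τ μ sv) x‖ ≤
  MH_line(d,α,a₋)·e^{−κ_line|x|_∞}`, `0 ≤ α < 1`, `sv ≠ 0`, `|sv_ν| ≤ n`), **`line_htorusKernel_decay_torusMetric`**, `line_htorusKernel_eq_periodise`.

With file 68 this is B4 LEMMA 2.4 (2.35)–(2.36), MULTIPLIER∕KERNEL FORM, FOR THE WHOLE TWO-CUTOFF LINE, uniformly in `s, n, L, a, τ, μ, sv` and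
the volume — R-E1's strip-engine half IN KERNEL.  What R-E1 does NOT yet have (HONEST): the operator-level identities on the fine torus
(«these multipliers ARE the kernels of `(T^𝕋(s) + aQ*Q)⁻¹Q*` and its difference derivatives» — b04 leaves the same identity untyped for
`G_jQ_j^*`, `B4Torus248Decay` (ii); for the line the ingredients are files 56–61), (2.37), and the boundary-condition versions (b04's
reflection ∕ Cor. 2.3 layers).  Nothing of Bałaban's asserted; no `sorry`.  Census only; NE7 NOT PRINTED ∕ NOT PROVED; spine 0∕9; FIXED
FINITE T⁴, rung (B)+1; NOT infinite volume, NOT mass gap, NOT Clay.  HONEST DEPENDENCY: continuum YM on T⁴ ⇐ BetaPertH ∧ nine spine estimates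
(0/9 proved); BetaPertH ⇐ (D1) ∧ (D4) ∧ CAP+tail; G-an2-4 gates asym, D1 and NE2/3/4.
-/

noncomputable section

open Finset Complex Set UnitAddTorus

namespace Summit.QuantumFields.BalabanUV.T4Continuum.NE7K1LinStripClassLineHolder

open Literature.MathematicalPhysics.QuantumFieldTheory.Balaban1983to89
open Literature.MathematicalPhysics.QuantumFieldTheory.Balaban1983to89.B4Strip
open Literature.MathematicalPhysics.QuantumFieldTheory.Balaban1983to89.B4StripCauchy
open Literature.MathematicalPhysics.QuantumFieldTheory.Balaban1983to89.B4StripSums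
open Literature.MathematicalPhysics.QuantumFieldTheory.Balaban1983to89.B4ContourShift
open Literature.MathematicalPhysics.QuantumFieldTheory.Balaban1983to89.B4TorusKernel
open Literature.MathematicalPhysics.QuantumFieldTheory.Balaban1983to89.B4StripSumsDeriv (torusKernelD248)
open Literature.MathematicalPhysics.QuantumFieldTheory.Balaban1983to89.B4StripSumsHolder (torusKernelH248)
open NE7K1LinStripClass NE7K1LinStripClassCauchy NE7K1LinStripClassNN NE7K1LinStripClassKL NE7K1LinStripClassLine
open NE7K1LinStripClassSums NE7K1LinStripClassSumsDeriv NE7K1LinStripClassSumsHolder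

variable {d : ℕ}

/-! ### §1 The torus joiners over the class for the differentiated and the Hölder multipliers -/

/-- the finite-torus kernel of the DIFFERENTIATED (2.49) multiplier over the class (b04's `torusKernelD248` with `GD ↦ GDS`). [folklore] -/
def torusKernelDS (n : ℕ) [NeZero n] (σ : (Fin (d + 1) → ℂ) → ℂ) (a : ℝ) (τ : Fin (d + 1) → Fin n) (μ : Fin (d + 1))
    (N : Fin (d + 1) → ℕ) (x : Fin (d + 1) → ℤ) : ℂ :=
  (∏ i, ((N i : ℕ) : ℂ))⁻¹ * ∑ k : (i : Fin (d + 1)) → Fin (N i),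
    GDS n σ a τ μ (ofRealVec (fun i => 2 * Real.pi * rep (MultiPeriod.gridPt N k i))) * mFourier x (MultiPeriod.gridPt N k)

/-- the finite-torus kernel of the HÖLDER-QUOTIENT multiplier over the class (b04's `torusKernelH248` with `GH ↦ GHS`). [folklore] -/
def torusKernelHS (α : ℝ) (n : ℕ) [NeZero n] (σ : (Fin (d + 1) → ℂ) → ℂ) (a : ℝ) (τ : Fin (d + 1) → Fin n) (μ : Fin (d + 1))
    (sv : Fin (d + 1) → ℤ) (N : Fin (d + 1) → ℕ) (x : Fin (d + 1) → ℤ) : ℂ :=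
  (∏ i, ((N i : ℕ) : ℂ))⁻¹ * ∑ k : (i : Fin (d + 1)) → Fin (N i),
    GHS α n σ a τ μ sv (ofRealVec (fun i => 2 * Real.pi * rep (MultiPeriod.gridPt N k i))) * mFourier x (MultiPeriod.gridPt N k)

/-- definitional agreement with pv17's engine. [folklore] -/
theorem torusKernelDS_eq_torusKernel (n : ℕ) [NeZero n] (σ : (Fin (d + 1) → ℂ) → ℂ) (a : ℝ) (τ : Fin (d + 1) → Fin n)
    (μ : Fin (d + 1)) {κ M : ℝ} (hreg : StripRegular (d := d) (GDS n σ a τ μ) κ M) (hκ : 0 ≤ κ) (N : Fin (d + 1) → ℕ)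
    (x : Fin (d + 1) → ℤ) : torusKernelDS n σ a τ μ N x = MultiPeriod.torusKernel (descendC _ hreg hκ) N x := rfl

/-- definitional agreement with pv17's engine. [folklore] -/
theorem torusKernelHS_eq_torusKernel (α : ℝ) (n : ℕ) [NeZero n] (σ : (Fin (d + 1) → ℂ) → ℂ) (a : ℝ)
    (τ : Fin (d + 1) → Fin n) (μ : Fin (d + 1)) (sv : Fin (d + 1) → ℤ) {κ M : ℝ}
    (hreg : StripRegular (d := d) (GHS α n σ a τ μ sv) κ M) (hκ : 0 ≤ κ) (N : Fin (d + 1) → ℕ) (x : Fin (d + 1) → ℤ) :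
    torusKernelHS α n σ a τ μ sv N x = MultiPeriod.torusKernel (descendC _ hreg hκ) N x := rfl

/-- b04's differentiated torus kernel IS the class one at the block Laplacian. [folklore] -/
theorem torusKernelD248_eq_torusKernelDS (n : ℕ) [NeZero n] (a m2 : ℝ) (τ : Fin (d + 1) → Fin n) (μ : Fin (d + 1))
    (N : Fin (d + 1) → ℕ) (x : Fin (d + 1) → ℤ) :
    torusKernelD248 n a m2 τ μ N x = torusKernelDS n (DeltaXi n m2) a τ μ N x := rfl

/-- b04's Hölder torus kernel IS the class one at the block Laplacian. [folklore] -/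
theorem torusKernelH248_eq_torusKernelHS (α : ℝ) (n : ℕ) [NeZero n] (a m2 : ℝ) (τ : Fin (d + 1) → Fin n) (μ : Fin (d + 1))
    (sv : Fin (d + 1) → ℤ) (N : Fin (d + 1) → ℕ) (x : Fin (d + 1) → ℤ) :
    torusKernelH248 α n a m2 τ μ sv N x = torusKernelHS α n (DeltaXi n m2) a τ μ sv N x := rfl

variable {n : ℕ} {σ : (Fin (d + 1) → ℂ) → ℂ} {r CS Cup : ℝ}

/-- uniform torus decay of the differentiated multiplier's kernel over the class. [folklore] -/
theorem torusKernelDS_decay_torusMetric [NeZero n] (h : SymbS n σ r CS Cup) {aminus aplus a : ℝ} (ha : 0 < aminus)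
    (ha1 : aminus ≤ a) (ha2 : a ≤ aplus) (τ : Fin (d + 1) → Fin n) (μ : Fin (d + 1)) {N : Fin (d + 1) → ℕ}
    (hN : ∀ i, 1 ≤ N i) (x : Fin (d + 1) → ℤ) :
    ‖torusKernelDS n σ a τ μ N x‖ ≤ boundGDS d (cS (d + 1) aminus) Cup * periodConst (kappaS (d + 1) aminus aplus Cup r) d *
      Real.exp (-(kappaS (d + 1) aminus aplus Cup r / (d + 1) * MultiPeriod.torusSupNorm N x)) := by
  have hreg := GDS_stripRegular h ha ha1 ha2 τ μ
  have hκ := kappaS_pos (d + 1) ha h.cup_nonneg h.r_pos (aplus := aplus)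
  rw [torusKernelDS_eq_torusKernel n σ a τ μ hreg hκ.le N x]
  exact MultiPeriod.torusKernel_descend_decay_torusMetric hreg hκ hN x

/-- the differentiated torus kernel is the periodisation of its lattice kernel, over the class. [folklore] -/
theorem torusKernelDS_eq_periodise [NeZero n] (h : SymbS n σ r CS Cup) {aminus aplus a : ℝ} (ha : 0 < aminus)
    (ha1 : aminus ≤ a) (ha2 : a ≤ aplus) (τ : Fin (d + 1) → Fin n) (μ : Fin (d + 1)) {N : Fin (d + 1) → ℕ}
    (hN : ∀ i, 1 ≤ N i) (x : Fin (d + 1) → ℤ) :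
    torusKernelDS n σ a τ μ N x = ∑' m : Fin (d + 1) → ℤ, latticeKernel (GDS n σ a τ μ) (MultiPeriod.translate N x m) := by
  have hreg := GDS_stripRegular h ha ha1 ha2 τ μ
  have hκ := kappaS_pos (d + 1) ha h.cup_nonneg h.r_pos (aplus := aplus)
  rw [torusKernelDS_eq_torusKernel n σ a τ μ hreg hκ.le N x]
  exact MultiPeriod.torusKernel_descend_eq hreg hκ hN x

/-- uniform torus decay of the Hölder multiplier's kernel over the class (`sv ≠ 0`, `|sv_ν| ≤ n`, `0 ≤ α < 1`). [folklore] -/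
theorem torusKernelHS_decay_torusMetric [NeZero n] (h : SymbS n σ r CS Cup) {aminus aplus a : ℝ} (ha : 0 < aminus)
    (ha1 : aminus ≤ a) (ha2 : a ≤ aplus) (τ : Fin (d + 1) → Fin n) (μ : Fin (d + 1)) {sv : Fin (d + 1) → ℤ} (hσ0 : sv ≠ 0)
    (hσn : ∀ ν, |sv ν| ≤ n) {α : ℝ} (hα0 : 0 ≤ α) (hα1 : α < 1) {N : Fin (d + 1) → ℕ} (hN : ∀ i, 1 ≤ N i)
    (x : Fin (d + 1) → ℤ) :
    ‖torusKernelHS α n σ a τ μ sv N x‖ ≤ boundGHS d α (cS (d + 1) aminus) Cup *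
      periodConst (kappaS (d + 1) aminus aplus Cup r) d *
      Real.exp (-(kappaS (d + 1) aminus aplus Cup r / (d + 1) * MultiPeriod.torusSupNorm N x)) := by
  have hreg := GHS_stripRegular h ha ha1 ha2 τ μ hσ0 hσn hα0 hα1
  have hκ := kappaS_pos (d + 1) ha h.cup_nonneg h.r_pos (aplus := aplus)
  rw [torusKernelHS_eq_torusKernel α n σ a τ μ sv hreg hκ.le N x]
  exact MultiPeriod.torusKernel_descend_decay_torusMetric hreg hκ hN x

/-- the Hölder torus kernel is the periodisation of its lattice kernel, over the class. [folklore] -/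
theorem torusKernelHS_eq_periodise [NeZero n] (h : SymbS n σ r CS Cup) {aminus aplus a : ℝ} (ha : 0 < aminus)
    (ha1 : aminus ≤ a) (ha2 : a ≤ aplus) (τ : Fin (d + 1) → Fin n) (μ : Fin (d + 1)) {sv : Fin (d + 1) → ℤ} (hσ0 : sv ≠ 0)
    (hσn : ∀ ν, |sv ν| ≤ n) {α : ℝ} (hα0 : 0 ≤ α) (hα1 : α < 1) {N : Fin (d + 1) → ℕ} (hN : ∀ i, 1 ≤ N i)
    (x : Fin (d + 1) → ℤ) :
    torusKernelHS α n σ a τ μ sv N x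
      = ∑' m : Fin (d + 1) → ℤ, latticeKernel (GHS α n σ a τ μ sv) (MultiPeriod.translate N x m) := by
  have hreg := GHS_stripRegular h ha ha1 ha2 τ μ hσ0 hσn hα0 hα1
  have hκ := kappaS_pos (d + 1) ha h.cup_nonneg h.r_pos (aplus := aplus)
  rw [torusKernelHS_eq_torusKernel α n σ a τ μ sv hreg hκ.le N x]
  exact MultiPeriod.torusKernel_descend_eq hreg hκ hN x

/-! ### §2 The two-cutoff line: the second quantity of (2.35) -/

/-- the line's derivative-kernel constant `MD_line(d, a₋) = boundGDS d (c_S(d+1, a₋)) (U_line(d+1))`. [folklore] -/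
def MDline (d : ℕ) (aminus : ℝ) : ℝ := boundGDS d (cS (d + 1) aminus) (CupLine (d + 1))

/-- the line's differentiated multiplier is strip regular on `Strip (d+1) κ_line`, every `s ∈ [0,1]`, `n`, `L`, `a ∈ [a₋,a₊]`, `τ`, `μ`. [folklore] -/
theorem line_GDS_stripRegular (L : ℕ) [NeZero L] (n : ℕ) [NeZero n] {s : ℝ} (hs0 : 0 ≤ s) (hs1 : s ≤ 1) {aminus aplus a : ℝ}
    (ha : 0 < aminus) (ha1 : aminus ≤ a) (ha2 : a ≤ aplus) (τ : Fin (d + 1) → Fin n) (μ : Fin (d + 1)) :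
    StripRegular (d := d) (GDS n (lineSymb L n s) a τ μ) (kappaLine (d + 1) aminus aplus) (MDline d aminus) :=
  GDS_stripRegular (symbS_line L n hs0 hs1) ha ha1 ha2 τ μ

/-- **B4 (2.35), SECOND QUANTITY, ALONG THE WHOLE TWO-CUTOFF LINE**: for `0 < a₋ ≤ a ≤ a₊`, EVERY `s ∈ [0,1]`, `n ≥ 1`, `L ≥ 1`, `τ`, `μ`,
`x ∈ ℤ^{d+1}`: `‖latticeKernel (GDS n σ_s^{(n)} a τ μ) x‖ ≤ MD_line(d,a₋)·e^{−κ_line(d+1,a₋,a₊)|x|_∞}`. [folklore] -/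
theorem line_dkernel_decay (L : ℕ) [NeZero L] (n : ℕ) [NeZero n] {s : ℝ} (hs0 : 0 ≤ s) (hs1 : s ≤ 1) {aminus aplus a : ℝ}
    (ha : 0 < aminus) (ha1 : aminus ≤ a) (ha2 : a ≤ aplus) (τ : Fin (d + 1) → Fin n) (μ : Fin (d + 1))
    (x : Fin (d + 1) → ℤ) :
    ‖latticeKernel (GDS n (lineSymb L n s) a τ μ) x‖
      ≤ MDline d aminus * Real.exp (-(kappaLine (d + 1) aminus aplus * supNorm x)) :=
  dkernelS_decay (symbS_line L n hs0 hs1) ha ha1 ha2 τ μ x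

/-- the line's second quantity on the finite torus, uniformly in the volume. [folklore] -/
theorem line_dtorusKernel_decay_torusMetric (L : ℕ) [NeZero L] (n : ℕ) [NeZero n] {s : ℝ} (hs0 : 0 ≤ s) (hs1 : s ≤ 1)
    {aminus aplus a : ℝ} (ha : 0 < aminus) (ha1 : aminus ≤ a) (ha2 : a ≤ aplus) (τ : Fin (d + 1) → Fin n) (μ : Fin (d + 1))
    {N : Fin (d + 1) → ℕ} (hN : ∀ i, 1 ≤ N i) (x : Fin (d + 1) → ℤ) :
    ‖torusKernelDS n (lineSymb L n s) a τ μ N x‖ ≤ MDline d aminus * periodConst (kappaLine (d + 1) aminus aplus) d *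
      Real.exp (-(kappaLine (d + 1) aminus aplus / (d + 1) * MultiPeriod.torusSupNorm N x)) :=
  torusKernelDS_decay_torusMetric (symbS_line L n hs0 hs1) ha ha1 ha2 τ μ hN x

/-- the line's differentiated torus kernel is the periodisation of its lattice kernel. [folklore] -/
theorem line_dtorusKernel_eq_periodise (L : ℕ) [NeZero L] (n : ℕ) [NeZero n] {s : ℝ} (hs0 : 0 ≤ s) (hs1 : s ≤ 1)
    {aminus aplus a : ℝ} (ha : 0 < aminus) (ha1 : aminus ≤ a) (ha2 : a ≤ aplus) (τ : Fin (d + 1) → Fin n) (μ : Fin (d + 1))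
    {N : Fin (d + 1) → ℕ} (hN : ∀ i, 1 ≤ N i) (x : Fin (d + 1) → ℤ) :
    torusKernelDS n (lineSymb L n s) a τ μ N x
      = ∑' m : Fin (d + 1) → ℤ, latticeKernel (GDS n (lineSymb L n s) a τ μ) (MultiPeriod.translate N x m) :=
  torusKernelDS_eq_periodise (symbS_line L n hs0 hs1) ha ha1 ha2 τ μ hN x

/-! ### §3 The two-cutoff line: the Hölder quotient (2.36) -/

/-- the line's Hölder-kernel constant `MH_line(d, α, a₋) = boundGHS d α (c_S(d+1, a₋)) (U_line(d+1))` (finite for `α < 1`). [folklore] -/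
def MHline (d : ℕ) (α aminus : ℝ) : ℝ := boundGHS d α (cS (d + 1) aminus) (CupLine (d + 1))

/-- the line's Hölder multiplier is strip regular on `Strip (d+1) κ_line`, every `s ∈ [0,1]`, `n`, `L`, `a ∈ [a₋,a₊]`, `τ`, `μ`, admissible
`sv`, `0 ≤ α < 1`. [folklore] -/
theorem line_GHS_stripRegular (L : ℕ) [NeZero L] (n : ℕ) [NeZero n] {s : ℝ} (hs0 : 0 ≤ s) (hs1 : s ≤ 1) {aminus aplus a : ℝ}
    (ha : 0 < aminus) (ha1 : aminus ≤ a) (ha2 : a ≤ aplus) (τ : Fin (d + 1) → Fin n) (μ : Fin (d + 1))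
    {sv : Fin (d + 1) → ℤ} (hσ0 : sv ≠ 0) (hσn : ∀ ν, |sv ν| ≤ n) {α : ℝ} (hα0 : 0 ≤ α) (hα1 : α < 1) :
    StripRegular (d := d) (GHS α n (lineSymb L n s) a τ μ sv) (kappaLine (d + 1) aminus aplus) (MHline d α aminus) :=
  GHS_stripRegular (symbS_line L n hs0 hs1) ha ha1 ha2 τ μ hσ0 hσn hα0 hα1

/-- **B4 (2.36) ALONG THE WHOLE TWO-CUTOFF LINE**: for `0 < a₋ ≤ a ≤ a₊`, `0 ≤ α < 1`, EVERY `s ∈ [0,1]`, `n ≥ 1`, `L ≥ 1`, `τ`, `μ`,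
`sv ≠ 0` with `|sv_ν| ≤ n`, and every `x ∈ ℤ^{d+1}`:
`‖latticeKernel (GHS α n σ_s^{(n)} a τ μ sv) x‖ ≤ MH_line(d,α,a₋)·e^{−κ_line(d+1,a₋,a₊)|x|_∞}` — the Hölder quotient of the
line's differentiated (2.48) kernel decays with the line's one rate; constants functions of `(d, α, a₋, a₊)` ALONE. [folklore] -/
theorem line_hkernel_decay (L : ℕ) [NeZero L] (n : ℕ) [NeZero n] {s : ℝ} (hs0 : 0 ≤ s) (hs1 : s ≤ 1) {aminus aplus a : ℝ}
    (ha : 0 < aminus) (ha1 : aminus ≤ a) (ha2 : a ≤ aplus) (τ : Fin (d + 1) → Fin n) (μ : Fin (d + 1))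
    {sv : Fin (d + 1) → ℤ} (hσ0 : sv ≠ 0) (hσn : ∀ ν, |sv ν| ≤ n) {α : ℝ} (hα0 : 0 ≤ α) (hα1 : α < 1)
    (x : Fin (d + 1) → ℤ) :
    ‖latticeKernel (GHS α n (lineSymb L n s) a τ μ sv) x‖
      ≤ MHline d α aminus * Real.exp (-(kappaLine (d + 1) aminus aplus * supNorm x)) :=
  hkernelS_decay (symbS_line L n hs0 hs1) ha ha1 ha2 τ μ hσ0 hσn hα0 hα1 x

/-- the line's Hölder quotient on the finite torus, uniformly in the volume. [folklore] -/
theorem line_htorusKernel_decay_torusMetric (L : ℕ) [NeZero L] (n : ℕ) [NeZero n] {s : ℝ} (hs0 : 0 ≤ s) (hs1 : s ≤ 1)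
    {aminus aplus a : ℝ} (ha : 0 < aminus) (ha1 : aminus ≤ a) (ha2 : a ≤ aplus) (τ : Fin (d + 1) → Fin n) (μ : Fin (d + 1))
    {sv : Fin (d + 1) → ℤ} (hσ0 : sv ≠ 0) (hσn : ∀ ν, |sv ν| ≤ n) {α : ℝ} (hα0 : 0 ≤ α) (hα1 : α < 1)
    {N : Fin (d + 1) → ℕ} (hN : ∀ i, 1 ≤ N i) (x : Fin (d + 1) → ℤ) :
    ‖torusKernelHS α n (lineSymb L n s) a τ μ sv N x‖ ≤ MHline d α aminus * periodConst (kappaLine (d + 1) aminus aplus) d *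
      Real.exp (-(kappaLine (d + 1) aminus aplus / (d + 1) * MultiPeriod.torusSupNorm N x)) :=
  torusKernelHS_decay_torusMetric (symbS_line L n hs0 hs1) ha ha1 ha2 τ μ hσ0 hσn hα0 hα1 hN x

/-- the line's Hölder torus kernel is the periodisation of its lattice kernel. [folklore] -/
theorem line_htorusKernel_eq_periodise (L : ℕ) [NeZero L] (n : ℕ) [NeZero n] {s : ℝ} (hs0 : 0 ≤ s) (hs1 : s ≤ 1)
    {aminus aplus a : ℝ} (ha : 0 < aminus) (ha1 : aminus ≤ a) (ha2 : a ≤ aplus) (τ : Fin (d + 1) → Fin n) (μ : Fin (d + 1))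
    {sv : Fin (d + 1) → ℤ} (hσ0 : sv ≠ 0) (hσn : ∀ ν, |sv ν| ≤ n) {α : ℝ} (hα0 : 0 ≤ α) (hα1 : α < 1)
    {N : Fin (d + 1) → ℕ} (hN : ∀ i, 1 ≤ N i) (x : Fin (d + 1) → ℤ) :
    torusKernelHS α n (lineSymb L n s) a τ μ sv N x
      = ∑' m : Fin (d + 1) → ℤ, latticeKernel (GHS α n (lineSymb L n s) a τ μ sv) (MultiPeriod.translate N x m) :=
  torusKernelHS_eq_periodise (symbS_line L n hs0 hs1) ha ha1 ha2 τ μ hσ0 hσn hα0 hα1 hN x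

end Summit.QuantumFields.BalabanUV.T4Continuum.NE7K1LinStripClassLineHolder

end
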